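import Summits.AtomisticToContinuum.HydrodynamicLimit.Theses.RelayRaceLocality
import Summits.AtomisticToContinuum.HydrodynamicLimit.Theorems.RelayRaceLocalityNearConstantShortTimeHLEntropyToLLN
import Summits.AtomisticToContinuum.HydrodynamicLimit.Theorems.RelayRaceLocalityNearConstantShortTimeHLMeansPinDefs
import Summits.AtomisticToContinuum.HydrodynamicLimit.Theorems.RelayRaceLocalityNearConstantShortTimeHLTiltDomination
import Summits.AtomisticToContinuum.HydrodynamicLimit.Theorems.RelayRaceLocalityNearConstantShortTimeHLSmallTiltDefs
import Summits.AtomisticToContinuum.HydrodynamicLimit.Theorems.RelayRaceLocalityNearConstantShortTimeHLStaticLLN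
import Summits.AtomisticToContinuum.HydrodynamicLimit.Theorems.RelayRaceLocalityNearConstantShortTimeHLUniformPressure
import Summits.AtomisticToContinuum.HydrodynamicLimit.Theorems.RelayRaceLocalityNearConstantShortTimeHLSmallTiltDock
import Summits.AtomisticToContinuum.HydrodynamicLimit.Theorems.RelayRaceLocalityNearConstantShortTimeHLGronwallReduction
import Summits.AtomisticToContinuum.HydrodynamicLimit.Theorems.RelayRaceLocalityNearConstantShortTimeHLMeansPin
import Summits.AtomisticToContinuum.HydrodynamicLimit.Theorems.RelayRaceLocalityNearConstantShortTimeHLGeneralFamilyLDA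
import Summits.AtomisticToContinuum.HydrodynamicLimit.Theorems.RelayRaceLocalityNearConstantShortTimeHLGeneralFamilyConcentration
import Summits.AtomisticToContinuum.HydrodynamicLimit.Theorems.RelayRaceLocalityNearConstantShortTimeHLSt2SplitDefs
import Summits.AtomisticToContinuum.HydrodynamicLimit.Theorems.RelayRaceLocalityNearConstantShortTimeHLPositionLDReduction
import Summits.AtomisticToContinuum.HydrodynamicLimit.Theorems.RelayRaceLocalityNearConstantShortTimeHLStubBallGaussian
import Summits.AtomisticToContinuum.HydrodynamicLimit.Theorems.RelayRaceLocalityNearConstantShortTimeHLVelocityLD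
import Summits.AtomisticToContinuum.HydrodynamicLimit.Theorems.RelayRaceLocalityNearConstantShortTimeHLDynamic
import HarnessLib

/-!
# Crux `NearConstantShortTimeHL` (stmt-AtomisticToContinuum-12502), line `small-tilt-domination` — THE ENDGAME OF THE LINE

With the level-1 dynamic theorem `stub_dynamic` landed (`Theorems/…Dynamic.lean`), the level-0 reduction `stub_reduction` (p130680), the
means-pin dock (`stub_meansPin`, `stub_ldaGeneralFamilies`, `stub_concentrationGeneralFamilies`, `stub_meansToRelEntropy`,
`meansConverge_of_nearConstantRelEntropy`), the landed statics (`stub_staticLLN`, `stub_uniformPressure`, `stub_smallTiltDomination`) and the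
entropy→LLN step (`stub_entropyToLLN`), the crux is reduced, kernel-checked, to its four open inputs — the registered endgames of lead c4:

* `gronwallAssembly_of_inputs : MesoscaleSuperlinearityE → UniformPressureAlongSolution → GeneralFamilyStaticLLN → TiltDomination →
   MomentumClosureTightnessUR → EnergyClosureTightnessUR → TrueLawCapsG → MeansConverge`;
* `nearConstantShortTimeHL_of_inputs : MesoscaleSuperlinearityE → MomentumClosureTightnessUR → EnergyClosureTightnessUR → TrueLawCapsG →
   NearConstantShortTimeHL`;

and, with the velocity side of St2′ closed this cycle (`stub_velocityLD`, `stub_ballGaussianEstimate`, `positionMesoscaleLD_of_densityLD`,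
`mesoscaleSuperlinearityE_of`), to the pure mesoscale DENSITY large deviation plus the three equilibrium / a-priori inputs:

* `nearConstantShortTimeHL_of_densityLD : MesoscaleDensityLD → MomentumClosureTightnessUR → EnergyClosureTightnessUR → TrueLawCapsG →
   NearConstantShortTimeHL`.

References: H.-T. Yau, Lett. Math. Phys. 22 (1991) §2.
-/

noncomputable section

namespace Summit.AtomisticToContinuum.HydrodynamicLimit.Theorems.NearConstantShortTimeHL

open Summit.AtomisticToContinuum.HydrodynamicLimit.Theses.RelayRaceLocality (NearConstantShortTimeHL)

/-- **Registered endgame `gronwallAssembly_of_inputs`** (lead c4's registration; `MeansConverge` from the statics and the three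
equilibrium / a-priori inputs): level 0 (`stub_reduction`) ∘ level 1 (`stub_dynamic`), through the means-pin dock. [cite: Yau1991, §2] -/
theorem gronwallAssembly_of_inputs : MesoscaleSuperlinearityE → UniformPressureAlongSolution → GeneralFamilyStaticLLN → TiltDomination → MomentumClosureTightnessUR → EnergyClosureTightnessUR → TrueLawCapsG → MeansConverge :=
  fun hSt2 hSt3 hS5a hS1 hS2 hS3 hS4 =>
    meansConverge_of_nearConstantRelEntropy
      (stub_meansPin stub_ldaGeneralFamilies stub_concentrationGeneralFamilies
        (stub_reduction stub_dynamic hSt2 hSt3 hS5a hS1 hS2 hS3 hS4))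

/-- **Registered endgame `nearConstantShortTimeHL_of_inputs`** (lead c4's registration): THE CRUX from its four open inputs — the mesoscale
static superlinearity St2′ and the equilibrium momentum / energy closure tightness at a uniform rate (S2, S3) and the a-priori caps with Gaussian
velocity tails along the true law (S4′). [cite: Yau1991, §2] -/
theorem nearConstantShortTimeHL_of_inputs : MesoscaleSuperlinearityE → MomentumClosureTightnessUR → EnergyClosureTightnessUR → TrueLawCapsG → NearConstantShortTimeHL :=
  fun hSt2 hS2 hS3 hS4 =>
    stub_entropyToLLN (stub_meansToRelEntropy
      (gronwallAssembly_of_inputs hSt2 stub_uniformPressure stub_staticLLN stub_smallTiltDomination hS2 hS3 hS4))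

/-- **THE CRUX FROM THE DENSITY LARGE DEVIATION AND THE THREE EQUILIBRIUM / A-PRIORI INPUTS** (lead c6): the velocity side of St2′ is closed
(`stub_velocityLD stub_ballGaussianEstimate`), the position side is packing + bias over `MesoscaleDensityLD`. [cite: Yau1991, §2] -/
theorem nearConstantShortTimeHL_of_densityLD : MesoscaleDensityLD → MomentumClosureTightnessUR → EnergyClosureTightnessUR → TrueLawCapsG → NearConstantShortTimeHL :=
  fun hD => nearConstantShortTimeHL_of_inputs
    (mesoscaleSuperlinearityE_of (positionMesoscaleLD_of_densityLD hD) (stub_velocityLD stub_ballGaussianEstimate))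

end Summit.AtomisticToContinuum.HydrodynamicLimit.Theorems.NearConstantShortTimeHL

end
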